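import Literature.Computability.Complexity.GapPVParse
import Literature.Analysis.FunctionSpaces.PVYard
import HarnessLib

/-!
# The gap machine in Cobham's class, II: writing the code of a CNF

The converse of `GapPVParse.lean`: from a *descriptor* of a CNF — definable functions giving the number
of clauses `M N`, the clause lengths `K N j`, the variables `V N j i` and the polarities `P N j i ∈ {0,1}`
— the string number `sn (encodingCNF.encode φ)` of the described formula is computed inside Cobham's
class.  Strings are handled as (value, length) pairs: `bitsToNat (boolPair x y) = pairV ⟦x⟧ |x| ⟦y⟧`
with `pairV a ℓ y = dupV a ℓ + 2^{2ℓ+1} + 2^{2ℓ+2} y` (`dupV` doubles the bits), list bodies are folded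
from the back (`bodyV`, a `loopNat`), and `sn w = ⟦w⟧ + 2^{|w|}`.  Definability needs every length
clamped by a polynomial cap `capL e N = |yd N|^(e+1)` (`GapPV.dupC`, `pairC`, …: the clamped versions,
equal to the mathematical ones below the cap).

* `dupV`, `pairV`, `bitsToNat_boolPair`, `bodyV`, `bitsToNat_body`, `loopNat_eq_bodyV`;
* the clamped encoder `litV/litL`, `lbV/lbL`, `clV/clL`, `cbV/cbL`, `cnfV/cnfL`, **`snEnc`**, with
  `pv_snEnc` (in Cobham's class when the descriptor is) and **`snEnc_eq`**: if the descriptor describes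
  `φ` and `|encode φ| ≤ capL e N` then `snEnc e … N = sn (encodingCNF.encode φ)`;
* `descCNF` — the formula described — and `snEnc_descCNF`.

## References

* S. Arora, B. Barak, *Computational Complexity: A Modern Approach*, CUP 2009, §0.1, §2.3.
* S. R. Buss, *Bounded Arithmetic*, 1986, Ch. 1–2 (polynomial length bounds in Cobham's class).
-/

namespace Literature.Computability.Complexity

open _root_.Computability Literature.Analysis.FunctionSpaces

namespace GapPV

open StrNum

/-! ### Values of pairs and bodies -/

/-- The value of the doubled string: `dupV a ℓ = ∑_{i<ℓ} 3 aᵢ 4ⁱ`. [folklore] -/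
def dupV (a ℓ : ℕ) : ℕ := sumBelow (fun i => (Nat.testBit a i).toNat * 3 * 4 ^ i) ℓ

/-- The value of a pair: `⟦boolPair x y⟧ = dupV ⟦x⟧ |x| + 2^{2|x|+1} + 2^{2|x|+2} ⟦y⟧`. [folklore] -/
def pairV (a ℓ y : ℕ) : ℕ := dupV a ℓ + 2 ^ (2 * ℓ + 1) + 2 ^ (2 * ℓ + 2) * y

/-- One more doubled bit. [folklore] -/
theorem dupV_succ (a ℓ : ℕ) : dupV a (ℓ + 1) = dupV a ℓ + (Nat.testBit a ℓ).toNat * 3 * 4 ^ ℓ := by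
  unfold dupV sumBelow; rw [Finset.sum_range_succ]

/-- `dupV` only sees the bits below `ℓ`. [folklore] -/
theorem dupV_congr {a b ℓ : ℕ} (h : ∀ i < ℓ, (Nat.testBit a i).toNat = (Nat.testBit b i).toNat) : dupV a ℓ = dupV b ℓ :=
  sumBelow_congr fun i hi => by rw [h i hi]

/-- `dupV a ℓ < 4^ℓ`. [folklore] -/
theorem dupV_lt (a ℓ : ℕ) : dupV a ℓ < 4 ^ ℓ := by
  induction ℓ with
  | zero => simp [dupV, sumBelow]
  | succ ℓ ih => rw [dupV_succ, pow_succ]; have := Bool.toNat_le (Nat.testBit a ℓ); nlinarith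

/-- **The value of the doubled string.** [folklore] -/
theorem bitsToNat_dup (x : List Bool) : bitsToNat (x.flatMap fun b => [b, b]) = dupV (bitsToNat x) x.length := by
  induction x using List.reverseRecOn with
  | nil => simp [dupV, sumBelow, bitsToNat]
  | append_singleton x b ih =>
    rw [List.flatMap_append, bitsToNat_append, ih, List.length_append, List.length_singleton, dupV_succ, List.length_flatMap]
    have hl : (x.map fun b => [b, b].length).sum = 2 * x.length := by
      induction x with
      | nil => rfl
      | cons c x ih' => simp [List.sum_cons] at ih' ⊢; omega
    rw [hl, dupV_congr (a := bitsToNat (x ++ [b])) (b := bitsToNat x) fun i hi => by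
      simp only [tb_bitsToNat, List.getD_eq_getElem?_getD, List.getElem?_append_left hi]]
    rw [tb_bitsToNat, List.getD_eq_getElem?_getD, List.getElem?_append_right le_rfl, Nat.sub_self]
    simp only [List.flatMap_cons, List.flatMap_nil, List.append_nil, List.getElem?_cons_zero, Option.getD_some]
    rw [pow_mul, show (2 : ℕ) ^ 2 = 4 by norm_num]
    cases b <;> simp [bitsToNat]
    omega

/-- **The value of a pair.** [folklore] -/
theorem bitsToNat_boolPair (x y : List Bool) : bitsToNat (boolPair x y) = pairV (bitsToNat x) x.length (bitsToNat y) := by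
  rw [boolPair_eq_append, bitsToNat_append, bitsToNat_append, bitsToNat_dup, List.length_append, List.length_flatMap]
  have hl : (x.map fun b => [b, b].length).sum = 2 * x.length := by
    induction x with
    | nil => rfl
    | cons c x ih' => simp [List.sum_cons] at ih' ⊢; omega
  rw [hl]
  simp [pairV, bitsToNat, pow_add, pow_mul]

/-- The value of a body from item `t` on, folded from the back. [folklore] -/
def bodyV (c : ℕ → List Bool) : ℕ → ℕ → ℕ
  | _, 0 => 0
  | t, k + 1 => pairV (bitsToNat (c t)) (c t).length (bodyV c (t + 1) k)

/-- **The value of a body.** [folklore] -/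
theorem bitsToNat_body (c : ℕ → List Bool) (t k : ℕ) : bitsToNat (body c t k) = bodyV c t k := by
  induction k generalizing t with
  | zero => rfl
  | succ k ih => rw [body, bodyV, bitsToNat_boolPair, ih]

/-- The length of a body. [folklore] -/
theorem length_body (c : ℕ → List Bool) (t k : ℕ) : (body c t k).length = sumBelow (fun i => 2 * (c (t + i)).length + 2) k := by
  induction k generalizing t with
  | zero => rfl
  | succ k ih =>
    rw [body, length_boolPair, ih, sumBelow, sumBelow, Finset.sum_range_succ', add_zero]
    simp only [show ∀ i, t + 1 + i = t + (i + 1) from fun i => by ring]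
    ring

/-- **The body as a loop from the back**: `k` rounds of `acc ↦ pairV (c (k-1-i)) … acc`. [folklore] -/
theorem loopNat_eq_bodyV (c : ℕ → List Bool) (k : ℕ) :
    ∀ j ≤ k, loopNat 0 (fun i acc => pairV (bitsToNat (c (k - 1 - i))) (c (k - 1 - i)).length acc) j = bodyV c (k - j) j := by
  intro j hj
  induction j with
  | zero => simp [bodyV]
  | succ j ih =>
    rw [loopNat_succ, ih (Nat.le_of_succ_le hj)]
    obtain ⟨t, ht⟩ : ∃ t, k - 1 - j = t ∧ k - j = t + 1 := ⟨k - 1 - j, rfl, by omega⟩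
    rw [ht.1, show k - (j + 1) = t by omega, bodyV, ht.2]

/-- A generic geometric bound for loops: if `st i acc ≤ C (acc + 1)` then `loopNat 0 st i ≤ (2C)^i`. [folklore] -/
theorem loopNat_le_pow {st : ℕ → ℕ → ℕ} {C : ℕ} (hC : 1 ≤ C) (h : ∀ i acc, st i acc ≤ C * (acc + 1)) :
    ∀ i, loopNat 0 st i ≤ (2 * C) ^ i
  | 0 => by simp
  | i + 1 => by
    rw [loopNat_succ, pow_succ]
    have ih := loopNat_le_pow hC h i
    have h1 : 1 ≤ (2 * C) ^ i := Nat.one_le_pow _ _ (by omega)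
    calc st i (loopNat 0 st i) ≤ C * (loopNat 0 st i + 1) := h i _
      _ ≤ C * ((2 * C) ^ i + (2 * C) ^ i) := Nat.mul_le_mul_left _ (by omega)
      _ = (2 * C) ^ i * (2 * C) := by ring

/-! ### Caps and clamped primitives -/

/-- The length scale `B N = |yd N| ≥ 65`. [folklore] -/
def Bsz (N : ℕ) : ℕ := (yd N).size

/-- The cap on lengths, `|yd N|^(e+1)`. [folklore] -/
def capL (e N : ℕ) : ℕ := Bsz N ^ (e + 1)

/-- The cap on exponents, `|yd N|^(e+2)`. [folklore] -/
def capE (e N : ℕ) : ℕ := Bsz N ^ (e + 2)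

/-- `2 capL + 2 ≤ capE`. [folklore] -/
theorem two_capL_le (e N : ℕ) : 2 * capL e N + 2 ≤ capE e N := by
  unfold capL capE
  have hB := size_yd_ge N
  have h1 : 1 ≤ Bsz N ^ (e + 1) := Nat.one_le_pow _ _ (by unfold Bsz; omega)
  rw [pow_succ (Bsz N) (e + 1)]
  unfold Bsz at *
  nlinarith

/-- `capL ≤ capE`. [folklore] -/
theorem capL_le_capE (e N : ℕ) : capL e N ≤ capE e N := by have := two_capL_le e N; omega

variable (e : ℕ)

/-- `Bsz` is in Cobham's class. [cite: Cobham1965] -/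
theorem pv_Bsz : PV₁ Bsz := (pv_yd.comp (IsPVDefinable.proj 0)).len

/-- `capL` is in Cobham's class (in `N`). [cite: Cobham1965] -/
theorem pv_capL : PV₁ (capL e) := by
  unfold PV₁ capL
  exact (pv_Bsz.comp (IsPVDefinable.proj 0)).pow_of_le_ypow (IsPVDefinable.const _) (pv_yd.comp (IsPVDefinable.proj 0)) (e + 1)
    fun v => (Nat.lt_pow_self (by have := size_yd_ge (v 0); omega)).le

/-- `capE` is in Cobham's class. [cite: Cobham1965] -/
theorem pv_capE : PV₁ (capE e) := by
  unfold PV₁ capE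
  exact (pv_Bsz.comp (IsPVDefinable.proj 0)).pow_of_le_ypow (IsPVDefinable.const _) (pv_yd.comp (IsPVDefinable.proj 0)) (e + 2)
    fun v => (Nat.lt_pow_self (by have := size_yd_ge (v 0); omega)).le

/-- `capE ≤ |yd|^(e+2)`. [folklore] -/
theorem capE_le (N : ℕ) : capE e N ≤ (yd N).size ^ (e + 2) := le_rfl

/-- Clamped power of two: `2^{min i capE}`. [folklore] -/
def p2 (N i : ℕ) : ℕ := 2 ^ min i (capE e N)

/-- Clamped power of four. [folklore] -/
def p4 (N i : ℕ) : ℕ := 4 ^ min i (capE e N)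

/-- `p2` is in Cobham's class. [cite: Buss1986, §2.2] -/
theorem pv_p2 : PV₂ (p2 e) :=
  IsPVDefinable.two_pow_of_le_ypow ((IsPVDefinable.proj 1).inf ((pv_capE e).comp (IsPVDefinable.proj 0))) (pv_yd.comp (IsPVDefinable.proj 0))
    (e + 2) fun _ => min_le_right _ _

/-- `p4` is in Cobham's class. [cite: Buss1986, §2.2] -/
theorem pv_p4 : PV₂ (p4 e) :=
  (IsPVDefinable.const 4).pow_of_le_ypow ((IsPVDefinable.proj 1).inf ((pv_capE e).comp (IsPVDefinable.proj 0))) (pv_yd.comp (IsPVDefinable.proj 0))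
    (e + 2) fun _ => min_le_right _ _

/-- `p2 = 2^i` below the cap. [folklore] -/
theorem p2_eq {N i : ℕ} (h : i ≤ capE e N) : p2 e N i = 2 ^ i := by unfold p2; rw [min_eq_left h]

/-- `p4 = 4^i` below the cap. [folklore] -/
theorem p4_eq {N i : ℕ} (h : i ≤ capE e N) : p4 e N i = 4 ^ i := by unfold p4; rw [min_eq_left h]

/-- `p2 ≤ 2^{capE}`, `p4 ≤ 4^{capE}`. [folklore] -/
theorem p2_le (N i : ℕ) : p2 e N i ≤ 2 ^ capE e N := Nat.pow_le_pow_right two_pos (min_le_right _ _)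

/-- Guarded powers of `4` stay below `4^{capE}`. [folklore] -/
theorem p4_le (N i : ℕ) : p4 e N i ≤ 4 ^ capE e N := Nat.pow_le_pow_right (by norm_num) (min_le_right _ _)

/-- Clamped doubling value. [folklore] -/
def dupC (N a ℓ : ℕ) : ℕ := sumBelow (fun i => (Nat.testBit a i).toNat * 3 * p4 e N i) (min ℓ (capL e N))

/-- `dupC = dupV` below the cap. [folklore] -/
theorem dupC_eq {N a ℓ : ℕ} (h : ℓ ≤ capL e N) : dupC e N a ℓ = dupV a ℓ := by
  unfold dupC dupV
  rw [min_eq_left h]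
  exact sumBelow_congr fun i hi => by rw [p4_eq e (by have := capL_le_capE e N; omega)]

/-- `dupC ≤ 3 capL 4^{capE}`. [folklore] -/
theorem dupC_le (N a ℓ : ℕ) : dupC e N a ℓ ≤ capL e N * (3 * 4 ^ capE e N) := by
  unfold dupC sumBelow
  calc ∑ i ∈ Finset.range (min ℓ (capL e N)), (Nat.testBit a i).toNat * 3 * p4 e N i ≤ ∑ i ∈ Finset.range (min ℓ (capL e N)), 3 * 4 ^ capE e N :=
        Finset.sum_le_sum fun i _ => by have := Bool.toNat_le (Nat.testBit a i); have := p4_le e N i; nlinarith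
    _ = min ℓ (capL e N) * (3 * 4 ^ capE e N) := by rw [Finset.sum_const, Finset.card_range, smul_eq_mul]
    _ ≤ capL e N * (3 * 4 ^ capE e N) := Nat.mul_le_mul_right _ (min_le_right _ _)

/-- `dupC` is in Cobham's class. [cite: Buss1986, Ch. 1] -/
theorem pv_dupC : PV₃ (dupC e) := by
  have hh : PV₄ fun N a (_ℓ : ℕ) i => (Nat.testBit a i).toNat * 3 * p4 e N i :=
    ((pv_tb.comp (IsPVDefinable.proj 1) (IsPVDefinable.proj 3)).mul (IsPVDefinable.const 3)).mul
      ((pv_p4 e).comp (IsPVDefinable.proj 0) (IsPVDefinable.proj 3))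
  refine PV₃.sumBelow (K₃ := fun N _ ℓ => min ℓ (capL e N)) (S₃ := fun N _ _ => ypow (yd N) (e + 1)) (M₃ := fun N _ _ => 3 * 4 ^ capE e N)
    hh ((IsPVDefinable.proj 2).inf ((pv_capL e).comp (IsPVDefinable.proj 0))) ((pv_yd.comp (IsPVDefinable.proj 0)).ypow (e + 1))
    (fun N _ _ => (min_le_right _ _).trans (pow_size_le _ (by omega))) ?_ fun N a ℓ i _ => ?_
  · exact (IsPVDefinable.const 3).mul ((IsPVDefinable.const 4).pow_of_le_ypow ((pv_capE e).comp (IsPVDefinable.proj 0))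
      (pv_yd.comp (IsPVDefinable.proj 0)) (e + 2) fun _ => le_rfl)
  · have := Bool.toNat_le (Nat.testBit a i); have := p4_le e N i; nlinarith

/-- Clamped pair value. [folklore] -/
def pairC (N a ℓ y : ℕ) : ℕ := dupC e N a ℓ + p2 e N (2 * ℓ + 1) + p2 e N (2 * ℓ + 2) * y

/-- `pairC = pairV` below the cap. [folklore] -/
theorem pairC_eq {N a ℓ : ℕ} (y : ℕ) (h : ℓ ≤ capL e N) : pairC e N a ℓ y = pairV a ℓ y := by
  unfold pairC pairV
  have := two_capL_le e N
  rw [dupC_eq e h, p2_eq e (by omega), p2_eq e (by omega)]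

/-- The growth constant of `pairC`: `Q = 2^{capE} (3 capL 4^{capE} + 2)`. [folklore] -/
def Qc (N : ℕ) : ℕ := 2 ^ capE e N * (capL e N * (3 * 4 ^ capE e N) + 2)

/-- `1 ≤ Qc`. [folklore] -/
theorem one_le_Qc (N : ℕ) : 1 ≤ Qc e N := Nat.mul_pos (by positivity) (by omega)

/-- `pairC ≤ Qc (y + 1)`. [folklore] -/
theorem pairC_le (N a ℓ y : ℕ) : pairC e N a ℓ y ≤ Qc e N * (y + 1) := by
  unfold pairC Qc
  have h1 := dupC_le e N a ℓ
  have h2 := p2_le e N (2 * ℓ + 1)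
  have h3 := p2_le e N (2 * ℓ + 2)
  have h4 : 1 ≤ 2 ^ capE e N := Nat.one_le_two_pow
  set D := capL e N * (3 * 4 ^ capE e N)
  set T := 2 ^ capE e N
  have h5 : D ≤ T * D := Nat.le_mul_of_pos_left D h4
  calc dupC e N a ℓ + p2 e N (2 * ℓ + 1) + p2 e N (2 * ℓ + 2) * y ≤ D + T + T * y := by
        have := Nat.mul_le_mul_right y h3; omega
    _ ≤ T * D * y + (T * D + 2 * T + 2 * (T * y)) := by omega
    _ = T * (D + 2) * (y + 1) := by ring

/-- `pairC` is in Cobham's class. [cite: Buss1986, Ch. 1] -/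
theorem pv_pairC : PV₄ (pairC e) :=
  (((pv_dupC e).comp (IsPVDefinable.proj 0) (IsPVDefinable.proj 1) (IsPVDefinable.proj 2)).add
    ((pv_p2 e).comp (IsPVDefinable.proj 0) (((IsPVDefinable.const 2).mul (IsPVDefinable.proj 2)).succ))).add
    (((pv_p2 e).comp (IsPVDefinable.proj 0) (((IsPVDefinable.const 2).mul (IsPVDefinable.proj 2)).add (IsPVDefinable.const 2))).mul
      (IsPVDefinable.proj 3))

/-- `Qc` is in Cobham's class. [cite: Buss1986, Ch. 1] -/
theorem pv_Qc : PV₁ (Qc e) := by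
  have h4 : IsPVDefinable fun v : Fin 1 → ℕ => 4 ^ capE e (v 0) :=
    (IsPVDefinable.const 4).pow_of_le_ypow ((pv_capE e).comp (IsPVDefinable.proj 0)) (pv_yd.comp (IsPVDefinable.proj 0)) (e + 2) fun _ => le_rfl
  have h2 : IsPVDefinable fun v : Fin 1 → ℕ => 2 ^ capE e (v 0) :=
    IsPVDefinable.two_pow_of_le_ypow ((pv_capE e).comp (IsPVDefinable.proj 0)) (pv_yd.comp (IsPVDefinable.proj 0)) (e + 2) fun _ => le_rfl
  exact h2.mul ((((pv_capL e).comp (IsPVDefinable.proj 0)).mul ((IsPVDefinable.const 3).mul h4)).add (IsPVDefinable.const 2))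

/-- The loop bound `(2 Qc)^{capL}`. [folklore] -/
def loopBd (N : ℕ) : ℕ := (2 * Qc e N) ^ capL e N

/-- `loopBd` is in Cobham's class. [cite: Buss1986, Ch. 1] -/
theorem pv_loopBd : PV₁ (loopBd e) :=
  ((IsPVDefinable.const 2).mul ((pv_Qc e).comp (IsPVDefinable.proj 0))).pow_of_le_ypow ((pv_capL e).comp (IsPVDefinable.proj 0))
    (pv_yd.comp (IsPVDefinable.proj 0)) (e + 1) fun _ => le_rfl

/-- Loops of `pairC` steps stay below `loopBd`. [folklore] -/
theorem loop_pairC_le (N : ℕ) (a ℓ : ℕ → ℕ) : ∀ i ≤ capL e N, loopNat 0 (fun t acc => pairC e N (a t) (ℓ t) acc) i ≤ loopBd e N := fun i hi =>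
  (loopNat_le_pow (one_le_Qc e N) (fun t acc => pairC_le e N (a t) (ℓ t) acc) i).trans (Nat.pow_le_pow_right (by have := one_le_Qc e N; omega) hi)

/-! ### The clamped encoder of a descriptor -/

section Encoder

variable (M : ℕ → ℕ) (K : ℕ → ℕ → ℕ) (V P : ℕ → ℕ → ℕ → ℕ)

/-- Value of the code of literal `i` of clause `j`. [folklore] -/
def litV (N j i : ℕ) : ℕ := pairC e N (V N j i) (V N j i).size (P N j i)

/-- Length of the code of literal `i` of clause `j`: `2|v| + 3` (clamped). [folklore] -/
def litL (N j i : ℕ) : ℕ := 2 * min (V N j i).size (capL e N) + 3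

/-- The clamped number of literals. [folklore] -/
def Kc (N j : ℕ) : ℕ := min (K N j) (capL e N)

/-- Value of the body of literal items of clause `j` (folded from the back). [folklore] -/
def lbV (N j : ℕ) : ℕ :=
  loopNat 0 (fun t acc => pairC e N (litV e V P N j (Kc e K N j - 1 - t)) (litL e V N j (Kc e K N j - 1 - t)) acc) (Kc e K N j)

/-- Length of that body. [folklore] -/
def lbL (N j : ℕ) : ℕ := sumBelow (fun i => 2 * litL e V N j i + 2) (Kc e K N j)

/-- Value of the code of clause `j` (unary header `1^k`: value `2^k - 1`, length `k`). [folklore] -/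
def clV (N j : ℕ) : ℕ := pairC e N (p2 e N (Kc e K N j) - 1) (Kc e K N j) (lbV e K V P N j)

/-- Length of the code of clause `j`. [folklore] -/
def clL (N j : ℕ) : ℕ := 2 * Kc e K N j + 2 + lbL e K V N j

/-- The clamped number of clauses. [folklore] -/
def Mc (N : ℕ) : ℕ := min (M N) (capL e N)

/-- Value of the body of clause items. [folklore] -/
def cbV (N : ℕ) : ℕ := loopNat 0 (fun t acc => pairC e N (clV e K V P N (Mc e M N - 1 - t)) (clL e K V N (Mc e M N - 1 - t)) acc) (Mc e M N)

/-- Length of the body of clause items. [folklore] -/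
def cbL (N : ℕ) : ℕ := sumBelow (fun j => 2 * clL e K V N j + 2) (Mc e M N)

/-- Value of the code of the formula. [folklore] -/
def cnfV (N : ℕ) : ℕ := pairC e N (p2 e N (Mc e M N) - 1) (Mc e M N) (cbV e M K V P N)

/-- Length of the code of the formula. [folklore] -/
def cnfL (N : ℕ) : ℕ := 2 * Mc e M N + 2 + cbL e M K V N

/-- **The string number of the code of the described formula.** [folklore] -/
def snEnc (N : ℕ) : ℕ := cnfV e M K V P N + p2 e N (cnfL e M K V N)

/-! ### Membership in Cobham's class -/

variable {M K V P}

/-- `litV` is in Cobham's class. [cite: Cobham1965] -/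
theorem pv_litV (hV : PV₃ V) (hP : PV₃ P) : PV₃ (litV e V P) :=
  (pv_pairC e).comp (IsPVDefinable.proj 0) (hV.comp (IsPVDefinable.proj 0) (IsPVDefinable.proj 1) (IsPVDefinable.proj 2))
    (hV.comp (IsPVDefinable.proj 0) (IsPVDefinable.proj 1) (IsPVDefinable.proj 2)).len (hP.comp (IsPVDefinable.proj 0) (IsPVDefinable.proj 1) (IsPVDefinable.proj 2))

/-- `litL` is in Cobham's class. [cite: Cobham1965] -/
theorem pv_litL (hV : PV₃ V) : PV₃ (litL e V) :=
  ((IsPVDefinable.const 2).mul ((hV.comp (IsPVDefinable.proj 0) (IsPVDefinable.proj 1) (IsPVDefinable.proj 2)).len.inf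
    ((pv_capL e).comp (IsPVDefinable.proj 0)))).add (IsPVDefinable.const 3)

/-- `litL ≤ 2 capL + 3`. [folklore] -/
theorem litL_le (N j i : ℕ) : litL e V N j i ≤ 2 * capL e N + 3 := by unfold litL; have := min_le_right (V N j i).size (capL e N); omega

/-- `Kc` is in Cobham's class. [cite: Cobham1965] -/
theorem pv_Kc (hK : PV₂ K) : PV₂ (Kc e K) := (hK.comp (IsPVDefinable.proj 0) (IsPVDefinable.proj 1)).inf ((pv_capL e).comp (IsPVDefinable.proj 0))

/-- `Kc ≤ capL`. [folklore] -/
theorem Kc_le (N j : ℕ) : Kc e K N j ≤ capL e N := min_le_right _ _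

/-- The yardstick bound for clamped counts. [folklore] -/
theorem capL_le_size_ypow (N : ℕ) : capL e N ≤ (ypow (yd N) (e + 1)).size := pow_size_le _ (by omega)

/-- `lbV` is in Cobham's class. [cite: Buss1986, Ch. 1] -/
theorem pv_lbV (hK : PV₂ K) (hV : PV₃ V) (hP : PV₃ P) : PV₂ (lbV e K V P) := by
  have hidx : IsPVDefinable fun v : Fin 4 → ℕ => Kc e K (v 0) (v 1) - 1 - v 2 :=
    (((pv_Kc e hK).comp (IsPVDefinable.proj 0) (IsPVDefinable.proj 1)).pred).sub (IsPVDefinable.proj 2)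
  have hSt : PV₄ fun N j t acc => pairC e N (litV e V P N j (Kc e K N j - 1 - t)) (litL e V N j (Kc e K N j - 1 - t)) acc :=
    (pv_pairC e).comp (IsPVDefinable.proj 0) ((pv_litV e hV hP).comp (IsPVDefinable.proj 0) (IsPVDefinable.proj 1) hidx)
      ((pv_litL e hV).comp (IsPVDefinable.proj 0) (IsPVDefinable.proj 1) hidx) (IsPVDefinable.proj 3)
  exact PV₂.loopNat (B₂ := fun _ _ => 0) (S₂ := fun N _ => ypow (yd N) (e + 1)) (Bd₂ := fun N _ => loopBd e N) (IsPVDefinable.const 0) hSt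
    (pv_Kc e hK) ((pv_yd.comp (IsPVDefinable.proj 0)).ypow (e + 1)) (fun N j => (Kc_le e N j).trans (capL_le_size_ypow e N))
    ((pv_loopBd e).comp (IsPVDefinable.proj 0)) fun N j i hi => loop_pairC_le e N _ _ i (hi.trans (Kc_le e N j))

/-- `lbL` is in Cobham's class. [cite: Buss1986, Ch. 1] -/
theorem pv_lbL (hK : PV₂ K) (hV : PV₃ V) : PV₂ (lbL e K V) :=
  PV₂.sumBelow (S₂ := fun N _ => ypow (yd N) (e + 1)) (M₂ := fun N _ => 2 * (2 * capL e N + 3) + 2)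
    (((IsPVDefinable.const 2).mul ((pv_litL e hV).comp (IsPVDefinable.proj 0) (IsPVDefinable.proj 1) (IsPVDefinable.proj 2))).add
      (IsPVDefinable.const 2)) (pv_Kc e hK)
    ((pv_yd.comp (IsPVDefinable.proj 0)).ypow (e + 1)) (fun N j => (Kc_le e N j).trans (capL_le_size_ypow e N))
    (((IsPVDefinable.const 2).mul (((IsPVDefinable.const 2).mul ((pv_capL e).comp (IsPVDefinable.proj 0))).add (IsPVDefinable.const 3))).add
      (IsPVDefinable.const 2)) fun N j i _ => by have := litL_le e (V := V) N j i; omega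

/-- `lbL ≤ capL (4 capL + 8)`. [folklore] -/
theorem lbL_le (N j : ℕ) : lbL e K V N j ≤ capL e N * (4 * capL e N + 8) := by
  unfold lbL sumBelow
  calc ∑ i ∈ Finset.range (Kc e K N j), (2 * litL e V N j i + 2) ≤ ∑ i ∈ Finset.range (Kc e K N j), (4 * capL e N + 8) :=
        Finset.sum_le_sum fun i _ => by have := litL_le e (V := V) N j i; omega
    _ = Kc e K N j * (4 * capL e N + 8) := by rw [Finset.sum_const, Finset.card_range, smul_eq_mul]
    _ ≤ capL e N * (4 * capL e N + 8) := Nat.mul_le_mul_right _ (Kc_le e N j)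

/-- `clV` is in Cobham's class. [cite: Cobham1965] -/
theorem pv_clV (hK : PV₂ K) (hV : PV₃ V) (hP : PV₃ P) : PV₂ (clV e K V P) :=
  (pv_pairC e).comp (IsPVDefinable.proj 0) (((pv_p2 e).comp (IsPVDefinable.proj 0) ((pv_Kc e hK).comp (IsPVDefinable.proj 0) (IsPVDefinable.proj 1))).pred)
    ((pv_Kc e hK).comp (IsPVDefinable.proj 0) (IsPVDefinable.proj 1)) ((pv_lbV e hK hV hP).comp (IsPVDefinable.proj 0) (IsPVDefinable.proj 1))

/-- `clL` is in Cobham's class. [cite: Cobham1965] -/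
theorem pv_clL (hK : PV₂ K) (hV : PV₃ V) : PV₂ (clL e K V) :=
  ((((IsPVDefinable.const 2).mul ((pv_Kc e hK).comp (IsPVDefinable.proj 0) (IsPVDefinable.proj 1))).add (IsPVDefinable.const 2))).add
    ((pv_lbL e hK hV).comp (IsPVDefinable.proj 0) (IsPVDefinable.proj 1))

/-- `clL ≤ 2 capL + 2 + capL (4 capL + 8)`. [folklore] -/
theorem clL_le (N j : ℕ) : clL e K V N j ≤ 2 * capL e N + 2 + capL e N * (4 * capL e N + 8) := by
  unfold clL; have := Kc_le e (K := K) N j; have := lbL_le e (K := K) (V := V) N j; omega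

/-- `Mc` is in Cobham's class. [cite: Cobham1965] -/
theorem pv_Mc (hM : PV₁ M) : PV₁ (Mc e M) := (hM.comp (IsPVDefinable.proj 0)).inf ((pv_capL e).comp (IsPVDefinable.proj 0))

/-- `Mc ≤ capL`. [folklore] -/
theorem Mc_le (N : ℕ) : Mc e M N ≤ capL e N := min_le_right _ _

/-- `cbV` is in Cobham's class. [cite: Buss1986, Ch. 1] -/
theorem pv_cbV (hM : PV₁ M) (hK : PV₂ K) (hV : PV₃ V) (hP : PV₃ P) : PV₁ (cbV e M K V P) := by
  have hidx : IsPVDefinable fun v : Fin 3 → ℕ => Mc e M (v 0) - 1 - v 1 :=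
    (((pv_Mc e hM).comp (IsPVDefinable.proj 0)).pred).sub (IsPVDefinable.proj 1)
  have hSt : PV₃ fun N t acc => pairC e N (clV e K V P N (Mc e M N - 1 - t)) (clL e K V N (Mc e M N - 1 - t)) acc :=
    (pv_pairC e).comp (IsPVDefinable.proj 0) ((pv_clV e hK hV hP).comp (IsPVDefinable.proj 0) hidx)
      ((pv_clL e hK hV).comp (IsPVDefinable.proj 0) hidx) (IsPVDefinable.proj 2)
  exact PV₁.loopNat (B := fun _ => 0) (S := fun N => ypow (yd N) (e + 1)) (Bd := loopBd e) (IsPVDefinable.const 0) hSt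
    (pv_Mc e hM) ((pv_yd.comp (IsPVDefinable.proj 0)).ypow (e + 1)) (fun N => (Mc_le e N).trans (capL_le_size_ypow e N))
    (pv_loopBd e) fun N i hi => loop_pairC_le e N _ _ i (hi.trans (Mc_le e N))

/-- `cbL` is in Cobham's class. [cite: Buss1986, Ch. 1] -/
theorem pv_cbL (hM : PV₁ M) (hK : PV₂ K) (hV : PV₃ V) : PV₁ (cbL e M K V) :=
  PV₁.sumBelow (S := fun N => ypow (yd N) (e + 1)) (M := fun N => 2 * (2 * capL e N + 2 + capL e N * (4 * capL e N + 8)) + 2)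
    (((IsPVDefinable.const 2).mul ((pv_clL e hK hV).comp (IsPVDefinable.proj 0) (IsPVDefinable.proj 1))).add (IsPVDefinable.const 2))
    (pv_Mc e hM) ((pv_yd.comp (IsPVDefinable.proj 0)).ypow (e + 1)) (fun N => (Mc_le e N).trans (capL_le_size_ypow e N))
    (((IsPVDefinable.const 2).mul ((((IsPVDefinable.const 2).mul ((pv_capL e).comp (IsPVDefinable.proj 0))).add (IsPVDefinable.const 2)).add
      (((pv_capL e).comp (IsPVDefinable.proj 0)).mul (((IsPVDefinable.const 4).mul ((pv_capL e).comp (IsPVDefinable.proj 0))).add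
        (IsPVDefinable.const 8))))).add (IsPVDefinable.const 2))
    fun N j _ => by have := clL_le e (K := K) (V := V) N j; omega

/-- `cnfV` is in Cobham's class. [cite: Cobham1965] -/
theorem pv_cnfV (hM : PV₁ M) (hK : PV₂ K) (hV : PV₃ V) (hP : PV₃ P) : PV₁ (cnfV e M K V P) :=
  (pv_pairC e).comp (IsPVDefinable.proj 0) (((pv_p2 e).comp (IsPVDefinable.proj 0) ((pv_Mc e hM).comp (IsPVDefinable.proj 0))).pred)
    ((pv_Mc e hM).comp (IsPVDefinable.proj 0)) ((pv_cbV e hM hK hV hP).comp (IsPVDefinable.proj 0))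

/-- `cnfL` is in Cobham's class. [cite: Cobham1965] -/
theorem pv_cnfL (hM : PV₁ M) (hK : PV₂ K) (hV : PV₃ V) : PV₁ (cnfL e M K V) :=
  ((((IsPVDefinable.const 2).mul ((pv_Mc e hM).comp (IsPVDefinable.proj 0))).add (IsPVDefinable.const 2))).add
    ((pv_cbL e hM hK hV).comp (IsPVDefinable.proj 0))

/-- **`snEnc` is in Cobham's class.** [cite: Cobham1965] -/
theorem pv_snEnc (hM : PV₁ M) (hK : PV₂ K) (hV : PV₃ V) (hP : PV₃ P) : PV₁ (snEnc e M K V P) :=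
  ((pv_cnfV e hM hK hV hP).comp (IsPVDefinable.proj 0)).add ((pv_p2 e).comp (IsPVDefinable.proj 0) ((pv_cnfL e hM hK hV).comp (IsPVDefinable.proj 0)))

end Encoder

/-! ### Correctness of the encoder -/

/-- `⟦1ᵏ⟧ = 2ᵏ - 1`. [folklore] -/
theorem bitsToNat_replicate_true' (k : ℕ) : bitsToNat (List.replicate k true) = 2 ^ k - 1 := by
  induction k with
  | zero => rfl
  | succ k ih =>
    rw [List.replicate_succ, bitsToNat_cons, ih, pow_succ]
    have : 1 ≤ 2 ^ k := Nat.one_le_two_pow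
    simp; omega

/-- Items are shorter than the body. [folklore] -/
theorem length_le_length_body (c : ℕ → List Bool) (t₀ : ℕ) {t k : ℕ} (ht : t < k) : (c (t₀ + t)).length + 2 ≤ (body c t₀ k).length := by
  rw [length_body]
  unfold sumBelow
  calc (c (t₀ + t)).length + 2 ≤ 2 * (c (t₀ + t)).length + 2 := by omega
    _ ≤ ∑ i ∈ Finset.range k, (2 * (c (t₀ + i)).length + 2) :=
        Finset.single_le_sum (f := fun i => 2 * (c (t₀ + i)).length + 2) (fun i _ => Nat.zero_le _) (Finset.mem_range.2 ht)

section Correct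

variable {e : ℕ} {M : ℕ → ℕ} {K : ℕ → ℕ → ℕ} {V P : ℕ → ℕ → ℕ → ℕ}

/-- The descriptor `(M, K, V, P)` describes `φ` at `N`. [folklore] -/
structure Describes (M : ℕ → ℕ) (K : ℕ → ℕ → ℕ) (V P : ℕ → ℕ → ℕ → ℕ) (φ : CNF ℕ) (N : ℕ) : Prop where
  /-- number of clauses -/
  m_eq : M N = φ.length
  /-- clause lengths -/
  k_eq : ∀ j (hj : j < φ.length), K N j = (φ[j]).length
  /-- variables -/
  v_eq : ∀ j (hj : j < φ.length) i (hi : i < (φ[j]).length), V N j i = ((φ[j])[i]).1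
  /-- polarities -/
  p_eq : ∀ j (hj : j < φ.length) i (hi : i < (φ[j]).length), P N j i = ((φ[j])[i]).2.toNat

variable (e)

/-- The clause codes and literal codes of `φ`, as functions. [folklore] -/
theorem encode_eq_body (φ : CNF ℕ) :
    encodingCNF.encode φ = boolPair (List.replicate φ.length true) (body (fun j => encodingClause.encode (φ.getD j [])) 0 φ.length) := by
  rw [encode_cnf, foldr_codes_eq_body encodingClause.encode φ []]

/-- The canonical code of a clause is `1¹⁰` followed by its body. [cite: AroraBarakCC2009, §0.1 (canonical representations)] -/
theorem encode_clause_eq_body (c : Clause ℕ) :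
    encodingClause.encode c = boolPair (List.replicate c.length true) (body (fun i => encodingLiteral.encode (c.getD i (0, false))) 0 c.length) := by
  rw [encode_clause, foldr_codes_eq_body encodingLiteral.encode c (0, false)]

/-- **Correctness of the encoder**: a descriptor of `φ` whose code fits under the cap yields
`sn (encodingCNF.encode φ)`. [cite: AroraBarakCC2009, §2.3] -/
theorem snEnc_eq {φ : CNF ℕ} {N : ℕ} (hD : Describes M K V P φ N) (hlen : (encodingCNF.encode φ).length ≤ capL e N) :
    snEnc e M K V P N = sn (encodingCNF.encode φ) := by
  have hcapE := two_capL_le e N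
  -- notation for the pieces of the code
  set cc : ℕ → List Bool := fun j => encodingClause.encode (φ.getD j []) with hcc
  have hφ : encodingCNF.encode φ = boolPair (List.replicate φ.length true) (body cc 0 φ.length) := encode_eq_body φ
  have hlenφ : (encodingCNF.encode φ).length = 2 * φ.length + 2 + (body cc 0 φ.length).length := by
    rw [hφ, length_boolPair, List.length_replicate]
  have hm : φ.length ≤ capL e N := by omega
  have hMc : Mc e M N = φ.length := by unfold Mc; rw [hD.m_eq, min_eq_left hm]
  -- clause level
  have hcl : ∀ j (hj : j < φ.length), (cc j).length ≤ capL e N ∧ clL e K V N j = (cc j).length ∧ clV e K V P N j = bitsToNat (cc j) := by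
    intro j hj
    have hccj : cc j = encodingClause.encode (φ[j]) := by
      simp only [hcc]; rw [List.getD_eq_getElem?_getD, List.getElem?_eq_getElem hj]; rfl
    have hlenj : (cc j).length ≤ capL e N := by
      have := length_le_length_body cc 0 hj
      rw [zero_add] at this; omega
    set ll : ℕ → List Bool := fun i => encodingLiteral.encode ((φ[j]).getD i (0, false)) with hll
    have hcj : cc j = boolPair (List.replicate (φ[j]).length true) (body ll 0 (φ[j]).length) := by rw [hccj, encode_clause_eq_body]
    have hlencj : (cc j).length = 2 * (φ[j]).length + 2 + (body ll 0 (φ[j]).length).length := by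
      rw [hcj, length_boolPair, List.length_replicate]
    have hk : (φ[j]).length ≤ capL e N := by omega
    have hKc : Kc e K N j = (φ[j]).length := by unfold Kc; rw [hD.k_eq j hj, min_eq_left hk]
    -- literal level
    have hlit : ∀ i (hi : i < (φ[j]).length), litL e V N j i = (ll i).length ∧ litV e V P N j i = bitsToNat (ll i) := by
      intro i hi
      have hlli : ll i = boolPair (encodeNat ((φ[j])[i]).1) [((φ[j])[i]).2] := by
        simp only [hll]; rw [List.getD_eq_getElem?_getD, List.getElem?_eq_getElem hi]; rfl
      have hleni : (ll i).length ≤ capL e N := by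
        have := length_le_length_body ll 0 hi
        rw [zero_add] at this; omega
      have hsz : (V N j i).size ≤ capL e N := by
        rw [hD.v_eq j hj i hi]
        have : (ll i).length = 2 * (encodeNat ((φ[j])[i]).1).length + 2 + 1 := by rw [hlli, length_boolPair]; rfl
        rw [TM2Pass.length_encodeNat_eq_size] at this; omega
      refine ⟨?_, ?_⟩
      · unfold litL
        rw [min_eq_left hsz, hD.v_eq j hj i hi, hlli, length_boolPair, TM2Pass.length_encodeNat_eq_size]; rfl
      · unfold litV
        rw [pairC_eq e _ hsz, hD.v_eq j hj i hi, hD.p_eq j hj i hi, hlli, bitsToNat_boolPair, bitsToNat_encodeNat,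
          TM2Pass.length_encodeNat_eq_size]
        cases ((φ[j])[i]).2 <;> rfl
    have hlbL : lbL e K V N j = (body ll 0 (φ[j]).length).length := by
      unfold lbL; rw [hKc, length_body]
      exact sumBelow_congr fun i hi => by rw [(hlit i hi).1, zero_add]
    have hlbV : lbV e K V P N j = bitsToNat (body ll 0 (φ[j]).length) := by
      unfold lbV; rw [hKc, bitsToNat_body]
      have h := loopNat_eq_bodyV ll (φ[j]).length (φ[j]).length le_rfl
      rw [Nat.sub_self] at h
      rw [← h]
      refine loopNat_congr fun t ht acc => ?_
      have hidx : (φ[j]).length - 1 - t < (φ[j]).length := by omega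
      rw [(hlit _ hidx).1, (hlit _ hidx).2, pairC_eq e]
      have := length_le_length_body ll 0 hidx
      rw [zero_add] at this; omega
    refine ⟨hlenj, ?_, ?_⟩
    · unfold clL; rw [hKc, hlbL, hlencj]
    · unfold clV
      rw [hKc, hlbV, pairC_eq e _ hk, p2_eq e (by omega), hcj, bitsToNat_boolPair, bitsToNat_replicate_true', List.length_replicate]
  -- formula level
  have hcbL : cbL e M K V N = (body cc 0 φ.length).length := by
    unfold cbL; rw [hMc, length_body]
    exact sumBelow_congr fun j hj => by rw [(hcl j hj).2.1, zero_add]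
  have hcbV : cbV e M K V P N = bitsToNat (body cc 0 φ.length) := by
    unfold cbV; rw [hMc, bitsToNat_body]
    have h := loopNat_eq_bodyV cc φ.length φ.length le_rfl
    rw [Nat.sub_self] at h
    rw [← h]
    refine loopNat_congr fun t ht acc => ?_
    have hidx : φ.length - 1 - t < φ.length := by omega
    rw [(hcl _ hidx).2.1, (hcl _ hidx).2.2, pairC_eq e _ (hcl _ hidx).1]
  have hcnfL : cnfL e M K V N = (encodingCNF.encode φ).length := by unfold cnfL; rw [hMc, hcbL, hlenφ]
  have hcnfV : cnfV e M K V P N = bitsToNat (encodingCNF.encode φ) := by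
    unfold cnfV
    rw [hMc, hcbV, pairC_eq e _ hm, p2_eq e (by omega), hφ, bitsToNat_boolPair, bitsToNat_replicate_true', List.length_replicate]
  unfold snEnc
  rw [hcnfV, hcnfL, p2_eq e (by omega), sn_eq]

/-- **The formula described by a descriptor** (used for the parsed input). [folklore] -/
def descCNF (M : ℕ → ℕ) (K : ℕ → ℕ → ℕ) (V P : ℕ → ℕ → ℕ → ℕ) (N : ℕ) : CNF ℕ :=
  (List.range (M N)).map fun j => (List.range (K N j)).map fun i => (V N j i, decide (P N j i = 1))

/-- A descriptor with `0/1` polarities describes its formula. [folklore] -/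
theorem describes_descCNF {N : ℕ} (hP : ∀ j i, P N j i ≤ 1) : Describes M K V P (descCNF M K V P N) N := by
  refine ⟨by simp [descCNF], fun j hj => ?_, fun j hj i hi => ?_, fun j hj i hi => ?_⟩
  · simp [descCNF] at hj ⊢
  · simp only [descCNF, List.getElem_map, List.getElem_range]
  · simp only [descCNF, List.getElem_map, List.getElem_range]
    have := hP j i
    interval_cases (P N j i) <;> simp

/-- The number of clauses of the described formula. [folklore] -/
theorem length_descCNF (N : ℕ) : (descCNF M K V P N).length = M N := by simp [descCNF]

/-- The clause lengths of the described formula. [folklore] -/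
theorem length_descCNF_get {N j : ℕ} (hj : j < (descCNF M K V P N).length) : ((descCNF M K V P N)[j]).length = K N j := by
  simp [descCNF, List.getElem_map]

end Correct

end GapPV

end Literature.Computability.Complexity
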